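import Summits.CriticalPhenomena.PercolationContinuityZ3.Theorems.PercNearOneGluingNoHeavyLowerTailSahiHardCoreReduction
import Summits.CriticalPhenomena.PercolationContinuityZ3.Theorems.PercNearOneGluingNoHeavyLowerTailSahiC4CubeEvents
import Summits.CriticalPhenomena.PercolationContinuityZ3.Theorems.PercNearOneGluingNoHeavyLowerTailSahiC3CubeAnyIndex
import Literature.Combinatorics.Sahi2008.Indicators
import HarnessLib

/-!
# `NoHeavyLowerTail` (stmt-CriticalPhenomena-4575) — Sahi's `C₄` on the FOUR-dimensional cube `{0,1}^4`, every product measure (kernel certificate × Theorem E)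

Support file, seat `prim-l12-p5` (gen 4), `--supports stmt-CriticalPhenomena-4575`, COMPUTATIONAL (`native_decide` for the certificate, as
`SahiC3Cube.checkCube_four`).  No definitions, no named facts, no sorries.

The tree's level-4 cube certificate (`SahiC4Cube.checkCube4`, seat `prim-masterthm-p3`) was evaluated for `m ≤ 3` only (`…SahiC4CubeLeThree`):
at `m = 4` the test ranges over the `C(171,4) ≈ 3.4·10⁷` sorted quadruples of the `168` increasing bitmasks.  The reduction of this lane
(`…SahiHardCoreReduction`, Theorem H / Theorem E of `…SahiDefectExpansion`) removes every quadruple in which SOME member contains the meet of the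
other three — for those `E₄ ≥ 0` follows from the kernel-checked `C₃` on `{0,1}^4` (`SahiC3Cube.sahiC3_of_card_le_four`) and Harris — and leaves
**82 093** non-absorbing quadruple-multisets (0.24 %), which the existing four-copy digit test (`SahiC4Cube.checkQuadW`, base `2^22`) certifies:

* `checkNA_four` — the digit test passes for every sorted NON-ABSORBING quadruple of increasing bitmasks of the `4`-cube (`native_decide`; the
  loop short-circuits on unsorted and on absorbing quadruples; written as a closed Boolean expression in the tree's checker vocabulary, no new
  definitions);
* `checkQuad_of_checkNA` — extraction of `checkQuad σ m A B C D` for such a quadruple (generic `m, σ`);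
* `inter_subset_of_land_encA` — the bitmask absorption test implies containment of events;
* `sahiE4_nonneg_of_inter_subset_four` — the ABSORBING case: `B ∩ C ∩ D ⊆ A ⇒ 0 ≤ sahiE4 (prodBernoulli p) A B C D` for increasing events of
  `Set (Fin 4)` (Theorem H with the kernel `C₃`; `sahiE_four_ind`);
* **`sahiC4_cube_four`** — for every `p : Fin 4 → [0,1]` and all increasing `A, B, C, D ⊆ Set (Fin 4)`: `0 ≤ sahiE4 (prodBernoulli p) A B C D`
  (Sahi 2008 Conj. 5 at order four / the master-family row (M-4) on the cube `{0,1}^4`; `m ≤ 3`: `SahiC4Cube.sahiC4_cube_le_three`);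
* `sahiPositive_bernoulliWeight_four_fin_four` — the function form `SahiPositive (bernoulliWeight p) 4` on `Set (Fin 4)` (layer cake), so that
  hierarchy lifting (`SahiHereditaryMeetAbsorption.sahiE_nonneg_of_sahiPositive_of_absorbing`, `k = 4`) applies on four coins.
-/

namespace Summit.CriticalPhenomena.PercolationContinuityZ3.Theorems

namespace SahiHereditaryMeetAbsorption

open Finset MeasureTheory Literature.Combinatorics.Sahi2008 SahiDefectExpansion
open OneCutCert FourCopyCert SahiC3Cube SahiC4Cube
open Literature.Probability.Percolation Literature.Probability.LatticeModels
open Literature.Probability.Percolation.DecisionTree (ind ind_of_mem ind_of_not_mem ind_nonneg)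

/-! ### The certificate on the non-absorbing quadruples -/

/-- **The non-absorbing level-4 cube check at `m = 4`, base `2^22`** (kernel evaluation, `native_decide`): for all increasing bitmasks
`A ≤ B ≤ C ≤ D` of the `4`-cube such that no member contains the AND of the other three, the digit test `checkQuadW` passes. [this file] -/
theorem checkNA_four :
    (let F : ℤ := krT5 22 4 (fullN 4)
     let off : ℤ := offM 22 4
     let offN : ℕ := off.toNat
     (upsN 4).all fun A => (upsN 4).all fun B => decide (B < A) || (upsN 4).all fun C => decide (C < B) ||
      (upsN 4).all fun D => decide (D < C) ||
        decide ((B &&& C &&& D) &&& A = B &&& C &&& D) || decide ((A &&& C &&& D) &&& B = A &&& C &&& D) ||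
        decide ((A &&& B &&& D) &&& C = A &&& B &&& D) || decide ((A &&& B &&& C) &&& D = A &&& B &&& C) ||
        checkQuadW 22 4 F off offN A B C D) = true := by
  native_decide

/-- Extraction (generic `m, σ`): if the short-circuiting non-absorbing check passes, every sorted non-absorbing quadruple of increasing
bitmasks passes `checkQuad σ m`. [this file] -/
theorem checkQuad_of_checkNA {m σ : ℕ}
    (hcheck : (let F : ℤ := krT5 σ m (fullN m)
     let off : ℤ := offM σ m
     let offN : ℕ := off.toNat
     (upsN m).all fun A => (upsN m).all fun B => decide (B < A) || (upsN m).all fun C => decide (C < B) ||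
      (upsN m).all fun D => decide (D < C) ||
        decide ((B &&& C &&& D) &&& A = B &&& C &&& D) || decide ((A &&& C &&& D) &&& B = A &&& C &&& D) ||
        decide ((A &&& B &&& D) &&& C = A &&& B &&& D) || decide ((A &&& B &&& C) &&& D = A &&& B &&& C) ||
        checkQuadW σ m F off offN A B C D) = true)
    (hσ : 0 < σ) (hbnd : 24 * 16 ^ m < 2 ^ (σ - 1))
    {A B C D : ℕ} (hA : A ∈ upsN m) (hB : B ∈ upsN m) (hC : C ∈ upsN m) (hD : D ∈ upsN m)
    (hAB : A ≤ B) (hBC : B ≤ C) (hCD : C ≤ D)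
    (h1 : ¬ (B &&& C &&& D) &&& A = B &&& C &&& D) (h2 : ¬ (A &&& C &&& D) &&& B = A &&& C &&& D)
    (h3 : ¬ (A &&& B &&& D) &&& C = A &&& B &&& D) (h4 : ¬ (A &&& B &&& C) &&& D = A &&& B &&& C) :
    checkQuad σ m A B C D = true := by
  simp only [List.all_eq_true, Bool.or_eq_true, decide_eq_true_eq] at hcheck
  rcases hcheck A hA B hB with k | key
  · exact absurd hAB (not_le.2 k)
  rcases key C hC with k | key
  · exact absurd hBC (not_le.2 k)
  rcases key D hD with (((((k | k) | k) | k) | k) | k)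
  · exact absurd hCD (not_le.2 k)
  · exact absurd k h1
  · exact absurd k h2
  · exact absurd k h3
  · exact absurd k h4
  · unfold checkQuad
    simp only [Bool.and_eq_true, decide_eq_true_eq]
    exact ⟨⟨hσ, hbnd⟩, k⟩

/-! ### Bitmask absorption ⇒ containment of events -/

/-- If the bitmask of `A` contains the AND of the bitmasks of `B, C, D`, then `B ∩ C ∩ D ⊆ A`. [this file] -/
theorem inter_subset_of_land_encA {m : ℕ} {A B C D : Set (Set (Fin m))}
    (h : (encA m B &&& encA m C &&& encA m D) &&& encA m A = encA m B &&& encA m C &&& encA m D) :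
    B ∩ C ∩ D ⊆ A := by
  classical
  rintro ω ⟨⟨hB, hC⟩, hD⟩
  set g : Fin m → Bool := fun i => decide (i ∈ ω) with hg
  have hpt : SahiC3Cube.pt m (enc2 g) = ω := by
    rw [pt_enc2]
    ext i
    simp [g]
  have tbit : ∀ X : Set (Set (Fin m)), (encA m X).testBit (enc2 g) = decide (ω ∈ X) := by
    intro X
    rw [testBit_encA, hpt]
    simp [enc2_lt g]
  have hbit := congrArg (fun n => Nat.testBit n (enc2 g)) h
  simp only [Nat.testBit_land, tbit, hB, hC, hD, decide_true, Bool.true_and] at hbit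
  simpa using hbit

/-! ### The absorbing case: Theorem H with the kernel `C₃` on four coins -/

/-- **Absorbing quadruples**: for a product measure on `2^{Fin 4}` and increasing `A, B, C, D` with `B ∩ C ∩ D ⊆ A`, `E₄(A,B,C,D) ≥ 0`
(Theorem E / H: `A` absorbs the meet of the others; the sub-triples are nonnegative by the kernel `C₃` on `≤ 4` coins, pairs by Harris).
[this file] -/
theorem sahiE4_nonneg_of_inter_subset_four (p : Fin 4 → unitInterval) {A B C D : Set (Set (Fin 4))}
    (hA : IsUpperSet A) (hB : IsUpperSet B) (hC : IsUpperSet C) (hD : IsUpperSet D) (habs : B ∩ C ∩ D ⊆ A) :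
    0 ≤ sahiE4 (prodBernoulli p) A B C D := by
  have key := bernoulliWeight_sahiE_ind_nonneg_of_hardCore_of_fourwise p 4 ![A, B, C, D]
    (fun i => by fin_cases i <;> assumption)
    (fun i j k _ _ _ _ _ => SahiC3Cube.sahiC3_of_card_le_four (by simp) p
      (by fin_cases i <;> assumption) (by fin_cases j <;> assumption) (by fin_cases k <;> assumption))
    (fun S hS => by
      have hSu : S = univ := Finset.eq_univ_of_card S (by simpa using hS)
      subst hSu
      refine ⟨0, mem_univ _, fun ω hω => habs ⟨⟨?_, ?_⟩, ?_⟩⟩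
      · exact hω 1 (by decide)
      · exact hω 2 (by decide)
      · exact hω 3 (by decide))
  have e : (fun i => ind (![A, B, C, D] i)) = ![ind A, ind B, ind C, ind D] := by
    funext i; fin_cases i <;> rfl
  rw [e, sahiE_four_ind] at key
  exact key

/-! ### Assembly: `C₄` on the four-dimensional cube -/

/-- **Sahi's `C₄` on `{0,1}^4` for every product measure**: for `p : Fin 4 → [0,1]` and increasing `A, B, C, D ⊆ Set (Fin 4)`,
`E₄(A,B,C,D) = 6μ(ABCD) − 2Σμ(A_i)μ(A_jA_kA_l) + Σμ(A_i)μ(A_j)μ(A_kA_l) − Σμ(A_iA_j)μ(A_kA_l) − μ(A)μ(B)μ(C)μ(D) ≥ 0`.  Absorbing quadruples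
by Theorem E and the kernel `C₃`; the 82 093 non-absorbing multisets by the four-copy certificate `checkNA_four`. [this file] -/
theorem sahiC4_cube_four (p : Fin 4 → unitInterval) {A B C D : Set (Set (Fin 4))}
    (hA : IsUpperSet A) (hB : IsUpperSet B) (hC : IsUpperSet C) (hD : IsUpperSet D) :
    0 ≤ sahiE4 (prodBernoulli p) A B C D := by
  let P : {X : Set (Set (Fin 4)) // IsUpperSet X} → {X : Set (Set (Fin 4)) // IsUpperSet X} →
      {X : Set (Set (Fin 4)) // IsUpperSet X} → {X : Set (Set (Fin 4)) // IsUpperSet X} → Prop :=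
    fun a b c d => 0 ≤ sahiE4 (prodBernoulli p) a.1 b.1 c.1 d.1
  have key : P ⟨A, hA⟩ ⟨B, hB⟩ ⟨C, hC⟩ ⟨D, hD⟩ := by
    refine forall_of_sorted₄ P (fun a => encA 4 a.1) ?_ ?_ ?_ ?_ ⟨A, hA⟩ ⟨B, hB⟩ ⟨C, hC⟩ ⟨D, hD⟩
    · intro a b c d habcd; simp only [P] at habcd ⊢; rwa [sahiE4_comm₁₂]
    · intro a b c d habcd; simp only [P] at habcd ⊢; rwa [sahiE4_comm₂₃]
    · intro a b c d habcd; simp only [P] at habcd ⊢; rwa [sahiE4_comm₃₄]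
    · intro a b c d hab hbc hcd
      simp only [P]
      by_cases h1 : (encA 4 b.1 &&& encA 4 c.1 &&& encA 4 d.1) &&& encA 4 a.1 = encA 4 b.1 &&& encA 4 c.1 &&& encA 4 d.1
      · exact sahiE4_nonneg_of_inter_subset_four p a.2 b.2 c.2 d.2 (inter_subset_of_land_encA h1)
      by_cases h2 : (encA 4 a.1 &&& encA 4 c.1 &&& encA 4 d.1) &&& encA 4 b.1 = encA 4 a.1 &&& encA 4 c.1 &&& encA 4 d.1
      · rw [sahiE4_comm₁₂]
        exact sahiE4_nonneg_of_inter_subset_four p b.2 a.2 c.2 d.2 (inter_subset_of_land_encA h2)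
      by_cases h3 : (encA 4 a.1 &&& encA 4 b.1 &&& encA 4 d.1) &&& encA 4 c.1 = encA 4 a.1 &&& encA 4 b.1 &&& encA 4 d.1
      · rw [sahiE4_comm₂₃, sahiE4_comm₁₂]
        exact sahiE4_nonneg_of_inter_subset_four p c.2 a.2 b.2 d.2 (inter_subset_of_land_encA h3)
      by_cases h4 : (encA 4 a.1 &&& encA 4 b.1 &&& encA 4 c.1) &&& encA 4 d.1 = encA 4 a.1 &&& encA 4 b.1 &&& encA 4 c.1
      · rw [sahiE4_comm₃₄, sahiE4_comm₂₃, sahiE4_comm₁₂]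
        exact sahiE4_nonneg_of_inter_subset_four p d.2 a.2 b.2 c.2 (inter_subset_of_land_encA h4)
      exact sahiE4_nonneg_of_checkQuad p (checkQuad_of_checkNA checkNA_four (by norm_num) (by norm_num)
        (encA_mem_upsN a.2) (encA_mem_upsN b.2) (encA_mem_upsN c.2) (encA_mem_upsN d.2) hab hbc hcd h1 h2 h3 h4)
  exact key

/-- **Order-`4` Sahi positivity of every product weight on `2^{Fin 4}`, function form** (layer cake). [this file] -/
theorem sahiPositive_bernoulliWeight_four_fin_four (p : Fin 4 → unitInterval) : SahiPositive (bernoulliWeight p) 4 := by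
  classical
  rw [sahiPositive_iff_indicators]
  intro U hU
  have hind : (fun i => setInd (U i)) =
      ![ind (U 0 : Set (Set (Fin 4))), ind (U 1 : Set (Set (Fin 4))), ind (U 2 : Set (Set (Fin 4))),
        ind (U 3 : Set (Set (Fin 4)))] := by
    funext i ω
    fin_cases i <;> simp [setInd_apply, ind]
  rw [hind, sahiE_four_ind]
  exact sahiC4_cube_four p (fun a b hab ha => hU 0 hab ha) (fun a b hab ha => hU 1 hab ha)
    (fun a b hab ha => hU 2 hab ha) (fun a b hab ha => hU 3 hab ha)

end SahiHereditaryMeetAbsorption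

end Summit.CriticalPhenomena.PercolationContinuityZ3.Theorems
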